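import Mathlib.Algebra.Order.Field.Rat
import Mathlib.Data.Real.Basic
import Mathlib.Data.Nat.Choose.Sum
import Mathlib.Algebra.BigOperators.Intervals
import Mathlib.Tactic.FieldSimp
import Mathlib.Tactic.Ring
import Mathlib.Tactic.Linarith
import Mathlib.Tactic.Positivity
import HarnessLib

/-!
# Bernstein forms on lists: conversion from the power basis and de Casteljau halving (generic, with proofs)

Venture `Crystal3D` (cell `pub-crystal3d`, phase 2; seat typer-bulk). Kernel- and compiler-evaluable list
algorithms for univariate Bernstein forms with coefficients in an arbitrary type `α` (numbers, or lists = the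
inner axes of a tensor), together with their real semantics through a functional `F : α → ℝ`:

* `bern n a s = C(n,a) sᵃ (1-s)ⁿ⁻ᵃ`, `bvF F z n b s = Σ_{a ≤ n} bern n a s · F(b[a])` (Bernstein-form value),
  `pvF F cs x = Σ_i xⁱ F(cs[i])` (power-form value, Horner);
* `toBern add smul lo hi cs` — the Bernstein coefficients, in degree `len cs - 1`, of `x ↦ pvF F cs x` on
  `[lo, hi]` (one fused Horner pass: `c + (lo(1-s) + hi s)·q`), with `bvF_toBern`;
* `castL` / `castR` — the de Casteljau coefficients of the two halves, scaled by `2ⁿ` so that everything stays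
  integral (`castL` = `2ⁿ⁻ᵃ ·` first entries of the summed rows, `castR` = reverse ∘ `castL` ∘ reverse); their
  soundness (`bvF_castL`, `bvF_castR`), linearity and the sign enclosures are in `CapBoxCasteljau.lean`.

All functions are structurally recursive on lists (no well-founded recursion), so `decide`/`native_decide`
evaluate them. HONEST FRAMING: elementary bookkeeping [folklore]; nothing geometric is proved here. This is the
one-dimensional layer of the tensor-Bernstein branch-and-bound used for the cap-cut inequality (II)
(`CapBoxCasteljau.lean`, `CapBoxTensor.lean`).
-/

open Finset

namespace Summit.Ventures.Crystal3D.CapCut.Bern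

variable {α : Type}

/-! ### List algorithms -/

/-- Elementwise combination of two lists, keeping the tail of the longer one. [folklore] -/
def lzip (add : α → α → α) : List α → List α → List α
  | a :: p, b :: q => add a b :: lzip add p q
  | [], q => q
  | p, [] => p

/-- Adjacent sums `[b₀+b₁, b₁+b₂, …]` (a de Casteljau row at the midpoint, unhalved). [folklore] -/
def sumRow (add : α → α → α) : List α → List α
  | a :: tl =>
    match tl with
    | [] => []
    | b :: _ => add a b :: sumRow add tl
  | [] => []

/-- Worker of `castL`: emit `sc e (row[0])`, then recurse on the summed row with exponent `e - 1`.
[folklore] -/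
def castLAux (add : α → α → α) (sc : ℕ → α → α) : ℕ → ℕ → List α → List α
  | 0, _, _ => []
  | fuel + 1, e, row =>
    match row with
    | [] => []
    | r0 :: _ => sc e r0 :: castLAux add sc fuel (e - 1) (sumRow add row)

/-- Scaled de Casteljau coefficients of the LEFT half `s ∈ [0, 1/2]`: `L_a = 2ⁿ⁻ᵃ · (row_a)[0]`
(`n = len - 1`, `row_{a+1} = sumRow row_a`), i.e. `2ⁿ` times the usual ones. [folklore] -/
def castL (add : α → α → α) (sc : ℕ → α → α) (b : List α) : List α :=
  castLAux add sc b.length (b.length - 1) b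

/-- Scaled de Casteljau coefficients of the RIGHT half `s ∈ [1/2, 1]` (reverse, left, reverse). [folklore] -/
def castR (add : α → α → α) (sc : ℕ → α → α) (b : List α) : List α :=
  (castL add sc b.reverse).reverse

/-- Worker of `hornerStep`: entries `a, a+1, …` of `c + x·q(x)`; arguments: position `a`, `m+1`,
the previous coefficient `b_{a-1}`, the remaining coefficients `b_a, …`. [folklore] -/
def hornerAux (add : α → α → α) (smul : ℚ → α → α) (lo hi : ℚ) (c : α) (m1 : ℕ) :
    ℕ → α → List α → List α
  | a, prev, [] => [add (smul ((a : ℚ) / m1 * hi) prev) c]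
  | a, prev, r :: rs =>
    add (add (smul ((a : ℚ) / m1 * hi) prev) (smul (((m1 : ℚ) - a) / m1 * lo) r)) c ::
      hornerAux add smul lo hi c m1 (a + 1) r rs

/-- One fused Horner step: from the Bernstein coefficients `b` (degree `m = len b - 1`) of `q` on
`[lo, hi]`, those of `c + x·q(x)` in degree `m + 1`:
`out_a = (a·hi·b_{a-1} + (m+1-a)·lo·b_a)/(m+1) + c`. [folklore] -/
def hornerStep (add : α → α → α) (smul : ℚ → α → α) (lo hi : ℚ) (c : α) (b : List α) : List α :=
  match b with
  | [] => [c]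
  | r :: rs => add (smul lo r) c :: hornerAux add smul lo hi c b.length 1 r rs

/-- Bernstein coefficients on `[lo, hi]`, in degree `len - 1`, of a power-form coefficient list
(lowest degree first). [folklore] -/
def toBern (add : α → α → α) (smul : ℚ → α → α) (lo hi : ℚ) : List α → List α
  | [] => []
  | [c] => [c]
  | c :: c' :: cs => hornerStep add smul lo hi c (toBern add smul lo hi (c' :: cs))

/-! ### Semantics -/

/-- The Bernstein basis polynomial `C(n,a) sᵃ (1-s)ⁿ⁻ᵃ`. [folklore] -/
def bern (n a : ℕ) (s : ℝ) : ℝ := (n.choose a : ℝ) * s ^ a * (1 - s) ^ (n - a)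

/-- Value of a Bernstein form of degree `n` with coefficients read through `F` (`z` = default entry).
[folklore] -/
def bvF (F : α → ℝ) (z : α) (n : ℕ) (b : List α) (s : ℝ) : ℝ :=
  ∑ a ∈ range (n + 1), bern n a s * F (b.getD a z)

/-- Value of a power form with coefficients read through `F` (Horner). [folklore] -/
def pvF (F : α → ℝ) : List α → ℝ → ℝ
  | [], _ => 0
  | c :: cs, x => F c + x * pvF F cs x

/-- `bern ≥ 0` on `[0, 1]`. [folklore] -/
theorem bern_nonneg (n a : ℕ) {s : ℝ} (h0 : 0 ≤ s) (h1 : s ≤ 1) : 0 ≤ bern n a s := by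
  unfold bern
  have : 0 ≤ 1 - s := by linarith
  positivity

/-- Partition of unity: `Σ_a bern n a s = 1` (all real `s`). [folklore] -/
theorem sum_bern (n : ℕ) (s : ℝ) : ∑ a ∈ range (n + 1), bern n a s = 1 := by
  have h := (add_pow s (1 - s) n).symm
  rw [show s + (1 - s) = 1 by ring, one_pow] at h
  rw [← h]
  refine Finset.sum_congr rfl fun a _ => ?_
  unfold bern; ring

/-- Degree raising by `s`: `bern (m+1) (a+1) s · (a+1)/(m+1) = s · bern m a s`. [folklore] -/
theorem bern_succ_succ_mul (m a : ℕ) (ha : a ≤ m) (s : ℝ) :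
    bern (m + 1) (a + 1) s * (((a : ℝ) + 1) / ((m : ℝ) + 1)) = s * bern m a s := by
  unfold bern
  have h' : ((m : ℝ) + 1) * (m.choose a : ℝ) = ((m + 1).choose (a + 1) : ℝ) * ((a : ℝ) + 1) := by
    exact_mod_cast Nat.add_one_mul_choose_eq m a
  have hm : ((m : ℝ) + 1) ≠ 0 := by positivity
  rw [show m + 1 - (a + 1) = m - a from by omega]
  calc ((m + 1).choose (a + 1) : ℝ) * s ^ (a + 1) * (1 - s) ^ (m - a) * (((a : ℝ) + 1) / ((m : ℝ) + 1))
      = (((m + 1).choose (a + 1) : ℝ) * ((a : ℝ) + 1)) / ((m : ℝ) + 1) * (s ^ (a + 1) * (1 - s) ^ (m - a)) := by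
        ring
    _ = (((m : ℝ) + 1) * (m.choose a : ℝ)) / ((m : ℝ) + 1) * (s ^ (a + 1) * (1 - s) ^ (m - a)) := by rw [h']
    _ = s * ((m.choose a : ℝ) * s ^ a * (1 - s) ^ (m - a)) := by
        rw [mul_comm ((m : ℝ) + 1) _, mul_div_assoc, div_self hm, mul_one, pow_succ]; ring

/-- Degree raising by `1 - s`: `bern (m+1) a s · (m+1-a)/(m+1) = (1-s) · bern m a s`. [folklore] -/
theorem bern_succ_mul (m a : ℕ) (ha : a ≤ m) (s : ℝ) :
    bern (m + 1) a s * (((m : ℝ) + 1 - a) / ((m : ℝ) + 1)) = (1 - s) * bern m a s := by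
  unfold bern
  have h' : (m.choose a : ℝ) * ((m : ℝ) + 1) = ((m + 1).choose a : ℝ) * ((m : ℝ) + 1 - a) := by
    have h := congrArg (fun x : ℕ => (x : ℝ)) (Nat.choose_mul_succ_eq m a)
    push_cast at h
    rw [Nat.cast_sub (by omega)] at h
    push_cast at h
    linarith
  have hm : ((m : ℝ) + 1) ≠ 0 := by positivity
  rw [show m + 1 - a = (m - a) + 1 from by omega, pow_succ]
  calc ((m + 1).choose a : ℝ) * s ^ a * ((1 - s) ^ (m - a) * (1 - s)) * (((m : ℝ) + 1 - a) / ((m : ℝ) + 1))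
      = (((m + 1).choose a : ℝ) * ((m : ℝ) + 1 - a)) / ((m : ℝ) + 1) * (s ^ a * (1 - s) ^ (m - a) * (1 - s)) := by
        ring
    _ = ((m.choose a : ℝ) * ((m : ℝ) + 1)) / ((m : ℝ) + 1) * (s ^ a * (1 - s) ^ (m - a) * (1 - s)) := by rw [h']
    _ = (1 - s) * ((m.choose a : ℝ) * s ^ a * (1 - s) ^ (m - a)) := by
        rw [mul_div_assoc, div_self hm, mul_one]; ring

/-! ### Linear functionals -/

/-- `F` reads `add`/`smul` as `+`/`·` and the default entry as `0`. [folklore] -/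
structure IsLin (F : α → ℝ) (z : α) (add : α → α → α) (smul : ℚ → α → α) : Prop where
  /-- default entry -/
  zero : F z = 0
  /-- additivity -/
  add : ∀ x y, F (add x y) = F x + F y
  /-- homogeneity -/
  smul : ∀ (c : ℚ) (x : α), F (smul c x) = (c : ℝ) * F x

/-! ### The Horner step -/

section Horner

variable {F : α → ℝ} {z : α} {add : α → α → α} {smul : ℚ → α → α}

/-- Entries of `hornerAux`: entry `i` combines `(prev :: rs)[i]` and `(prev :: rs)[i+1]`. [folklore] -/
theorem hornerAux_getD (hF : IsLin F z add smul) (lo hi : ℚ) (c : α) (m1 : ℕ) :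
    ∀ (rs : List α) (a : ℕ) (prev : α) (i : ℕ), i ≤ rs.length →
      F ((hornerAux add smul lo hi c m1 a prev rs).getD i z) =
        ((a : ℝ) + i) / (m1 : ℝ) * (hi : ℝ) * F ((prev :: rs).getD i z) +
          ((m1 : ℝ) - ((a : ℝ) + i)) / (m1 : ℝ) * (lo : ℝ) * F ((prev :: rs).getD (i + 1) z) + F c := by
  intro rs
  induction rs with
  | nil =>
    intro a prev i hi0
    have hi : i = 0 := by simpa using hi0
    subst hi
    simp only [hornerAux, List.getD_cons_zero, List.getD_cons_succ, List.getD_nil, hF.zero, hF.add, hF.smul]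
    push_cast; ring
  | cons r rs ih =>
    intro a prev i hi0
    cases i with
    | zero =>
      simp only [hornerAux, List.getD_cons_zero, List.getD_cons_succ, hF.add, hF.smul]
      push_cast; ring
    | succ i =>
      have hi' : i ≤ rs.length := by simpa using hi0
      simp only [hornerAux, List.getD_cons_succ]
      rw [ih (a + 1) r i hi']
      simp only [List.getD_cons_succ]
      push_cast; ring

/-- Entries of `hornerStep` for `b` of length `m + 1`:
`F(out_a) = (a/(m+1))·hi·F(b_{a-1}) + ((m+1-a)/(m+1))·lo·F(b_a) + F(c)` (`b_{-1}`, `b_{m+1}` read as `z`;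
the `a = 0` term has weight `0`). [folklore] -/
theorem hornerStep_getD (hF : IsLin F z add smul) (lo hi : ℚ) (c : α) (m : ℕ) (b : List α)
    (hb : b.length = m + 1) (a : ℕ) (ha : a ≤ m + 1) :
    F ((hornerStep add smul lo hi c b).getD a z) =
      (a : ℝ) / ((m : ℝ) + 1) * (hi : ℝ) * F (b.getD (a - 1) z) +
        (((m : ℝ) + 1 - a) / ((m : ℝ) + 1)) * (lo : ℝ) * F (b.getD a z) + F c := by
  cases b with
  | nil => simp at hb
  | cons r rs =>
    have hrs : rs.length = m := by simpa using hb
    cases a with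
    | zero =>
      simp only [hornerStep, List.getD_cons_zero, hF.add, hF.smul]
      have hm : ((m : ℝ) + 1) ≠ 0 := by positivity
      field_simp
      push_cast; ring
    | succ a =>
      have ha' : a ≤ rs.length := by omega
      simp only [hornerStep, List.getD_cons_succ, List.length_cons]
      rw [hornerAux_getD hF lo hi c (rs.length + 1) rs 1 r a ha', hrs, Nat.add_sub_cancel]
      simp only [List.getD_cons_succ]
      push_cast; ring

/-- Length of `hornerAux`. [folklore] -/
theorem hornerAux_length (lo hi : ℚ) (c : α) (m1 : ℕ) :
    ∀ (rs : List α) (a : ℕ) (prev : α), (hornerAux add smul lo hi c m1 a prev rs).length = rs.length + 1 := by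
  intro rs; induction rs with
  | nil => intro a prev; rfl
  | cons r rs ih => intro a prev; simp [hornerAux, ih]

/-- Length of `hornerStep`. [folklore] -/
theorem hornerStep_length (lo hi : ℚ) (c : α) (b : List α) :
    (hornerStep add smul lo hi c b).length = b.length + 1 := by
  cases b with
  | nil => rfl
  | cons r rs => simp [hornerStep, hornerAux_length]

/-- **The Horner step is sound**: for `b` of length `m + 1`,
`bvF (m+1) (hornerStep c b) s = F c + (lo(1-s) + hi·s) · bvF m b s`. [folklore] -/
theorem bvF_hornerStep (hF : IsLin F z add smul) (lo hi : ℚ) (c : α) (m : ℕ) (b : List α)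
    (hb : b.length = m + 1) (s : ℝ) :
    bvF F z (m + 1) (hornerStep add smul lo hi c b) s =
      F c + ((lo : ℝ) * (1 - s) + hi * s) * bvF F z m b s := by
  unfold bvF
  -- entrywise formula
  have hterm : ∀ a ∈ range (m + 1 + 1), bern (m + 1) a s * F ((hornerStep add smul lo hi c b).getD a z) =
      (hi : ℝ) * (bern (m + 1) a s * ((a : ℝ) / ((m : ℝ) + 1))) * F (b.getD (a - 1) z) +
        (lo : ℝ) * (bern (m + 1) a s * (((m : ℝ) + 1 - a) / ((m : ℝ) + 1))) * F (b.getD a z) +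
          bern (m + 1) a s * F c := by
    intro a ha
    have ha' : a ≤ m + 1 := by simpa [Nat.lt_succ_iff] using ha
    rw [hornerStep_getD hF lo hi c m b hb a ha']
    ring
  rw [Finset.sum_congr rfl hterm, Finset.sum_add_distrib, Finset.sum_add_distrib]
  -- third sum: partition of unity
  have h3 : ∑ a ∈ range (m + 1 + 1), bern (m + 1) a s * F c = F c := by
    rw [← Finset.sum_mul, sum_bern, one_mul]
  -- first sum: shift index, degree raising by s
  have h1 : ∑ a ∈ range (m + 1 + 1),
      (hi : ℝ) * (bern (m + 1) a s * ((a : ℝ) / ((m : ℝ) + 1))) * F (b.getD (a - 1) z) =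
      (hi : ℝ) * s * ∑ a ∈ range (m + 1), bern m a s * F (b.getD a z) := by
    rw [Finset.sum_range_succ']
    simp only [Nat.cast_zero, zero_div, mul_zero, zero_mul, add_zero, Nat.add_sub_cancel]
    rw [Finset.mul_sum]
    refine Finset.sum_congr rfl fun a ha => ?_
    have ha' : a ≤ m := by simpa [Nat.lt_succ_iff] using ha
    have := bern_succ_succ_mul m a ha' s
    push_cast at this ⊢
    rw [this]; ring
  -- second sum: drop last term, degree raising by (1 - s)
  have h2 : ∑ a ∈ range (m + 1 + 1),
      (lo : ℝ) * (bern (m + 1) a s * (((m : ℝ) + 1 - a) / ((m : ℝ) + 1))) * F (b.getD a z) =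
      (lo : ℝ) * (1 - s) * ∑ a ∈ range (m + 1), bern m a s * F (b.getD a z) := by
    rw [Finset.sum_range_succ]
    have hlast : (((m : ℝ) + 1 - (m + 1 : ℕ)) / ((m : ℝ) + 1)) = 0 := by push_cast; ring
    rw [hlast, mul_zero, mul_zero, zero_mul, add_zero, Finset.mul_sum]
    refine Finset.sum_congr rfl fun a ha => ?_
    have ha' : a ≤ m := by simpa [Nat.lt_succ_iff] using ha
    rw [bern_succ_mul m a ha' s]; ring
  rw [h1, h2, h3]; ring

/-- Length of `toBern`. [folklore] -/
theorem toBern_length (lo hi : ℚ) : ∀ cs : List α, (toBern add smul lo hi cs).length = cs.length := by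
  intro cs
  induction cs with
  | nil => rfl
  | cons c cs ih =>
    cases cs with
    | nil => rfl
    | cons c' cs => simp only [toBern, hornerStep_length, ih, List.length_cons]

/-- **The conversion is sound**: `bvF (len-1) (toBern cs) s = pvF cs (lo(1-s) + hi·s)` for every real
`s` (a polynomial identity; `[lo,hi] ∋ x = lo(1-s)+hi·s` for `s ∈ [0,1]`). [folklore] -/
theorem bvF_toBern (hF : IsLin F z add smul) (lo hi : ℚ) (s : ℝ) :
    ∀ cs : List α, bvF F z (cs.length - 1) (toBern add smul lo hi cs) s =
      pvF F cs ((lo : ℝ) * (1 - s) + hi * s) := by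
  intro cs
  induction cs with
  | nil => simp [bvF, toBern, pvF, hF.zero]
  | cons c cs ih =>
    cases cs with
    | nil =>
      simp [bvF, toBern, pvF, bern]
    | cons c' cs =>
      simp only [toBern, List.length_cons, Nat.add_sub_cancel] at ih ⊢
      rw [bvF_hornerStep hF lo hi c cs.length _ (by rw [toBern_length]; rfl) s, ih]
      simp only [pvF]

end Horner

end Summit.Ventures.Crystal3D.CapCut.Bern
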